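import Mathlib.MeasureTheory.Integral.MeanInequalities
import Mathlib.Analysis.SpecialFunctions.Pow.Real
import Literature.MathematicalPhysics.QuantumFieldTheory.BalabanBlockSpecification
import HarnessLib

/-!
# Route `SourcedPressureJensen`, crux `SourcedPressureDecoupling` (stmt-QuantumFields-24028): CONVEXITY of the
# log-partition functional `F ↦ log E e^F` (finite Hölder) — the "translation-averaged Jensen" step

Mechanism (1) of the item ("TRANSLATION-AVERAGED JENSEN removes the pairs straddling a seam exactly: `Σ_x H_x` is the average
over all torus translates `a` of `(1−f)⁻¹ Σ_{pairs interior to the tiling + a} H_x`, so by CONVEXITY of `F ↦ log E_T e^F` and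
translation invariance `INCR_T(h) ≤ …`") needs exactly the finite Hölder inequality for exponential moments.  This file proves:

* `integral_exp_sum_mul_le_prod_rpow` — for a probability measure, weights `w_i ≥ 0` with `Σ w_i = 1` and real `F_i` with
  `e^{F_i}` integrable: `e^{Σ w_i F_i}` is integrable and `∫ e^{Σ_i w_i F_i} ≤ Π_i (∫ e^{F_i})^{w_i}`
  (Mathlib's multi-argument Hölder `ENNReal.lintegral_prod_norm_pow_le`, moved to Bochner integrals);
* `log_integral_exp_sum_mul_le` — hence `log ∫ e^{Σ w_i F_i} ≤ Σ_i w_i log ∫ e^{F_i}` (convexity of the log-partition functional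
  along finite convex combinations);
* `log_wilsonExpectation_exp_sum_mul_le` / `log_wilsonExpectation_exp_avg_le` — the same for the torus Wilson state
  `wilsonExpectation r.ρ β` and CONTINUOUS potentials (weights / plain averages over a finite family);
* `log_wilsonExpectation_exp_avg_translates_le` — with torus translates `F ∘ τ_{v(a)}` of ONE continuous `F`
  (translation invariance `wilsonExpectation_comp_torusConfigShift`): `log E exp(|S|⁻¹ Σ_{a∈S} F ∘ τ_{v(a)}) ≤ log E exp F`.

Everything is proved; no definition, no named fact.  RECORD-label rung support (route target `XiPow` = an upper bound on the
lattice gap); the Yang–Mills mass gap is NOT proved by anything here. [folklore]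
-/

set_option autoImplicit false

noncomputable section

open MeasureTheory Real Finset
open scoped ENNReal
open Literature.MathematicalPhysics.QuantumFieldTheory Literature.MathematicalPhysics.QuantumLattice

namespace Summit.QuantumFields.YangMills.Theorems.SourcedPressureJensen

/-! ### Abstract probability space: finite Hölder for exponential moments -/

section Abstract

variable {α : Type*} [MeasurableSpace α] {μ : Measure α} [IsProbabilityMeasure μ] {ι : Type*}

omit [IsProbabilityMeasure μ] in
/-- **Finite Hölder for exponential moments.**  For weights `w_i ≥ 0`, `Σ_{i∈s} w_i = 1`, and real functions `F_i` with
`e^{F_i}` integrable (`i ∈ s`): `e^{Σ_i w_i F_i}` is integrable and `∫ e^{Σ_i w_i F_i} dμ ≤ Π_i (∫ e^{F_i} dμ)^{w_i}`.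
[folklore] -/
theorem integral_exp_sum_mul_le_prod_rpow (s : Finset ι) (w : ι → ℝ) (F : ι → α → ℝ)
    (hw0 : ∀ i ∈ s, 0 ≤ w i) (hw1 : ∑ i ∈ s, w i = 1)
    (hFi : ∀ i ∈ s, Integrable (fun x => Real.exp (F i x)) μ) :
    Integrable (fun x => Real.exp (∑ i ∈ s, w i * F i x)) μ ∧
      ∫ x, Real.exp (∑ i ∈ s, w i * F i x) ∂μ ≤ ∏ i ∈ s, (∫ x, Real.exp (F i x) ∂μ) ^ w i := by
  -- pointwise: `e^{Σ wF}` as a product of powers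
  have hreal : ∀ x, Real.exp (∑ i ∈ s, w i * F i x) = ∏ i ∈ s, Real.exp (F i x) ^ w i := by
    intro x
    rw [Real.exp_sum]
    refine Finset.prod_congr rfl fun i _ => ?_
    rw [mul_comm, Real.exp_mul]
  have hpt : ∀ x, ENNReal.ofReal (Real.exp (∑ i ∈ s, w i * F i x)) =
      ∏ i ∈ s, ENNReal.ofReal (Real.exp (F i x)) ^ w i := by
    intro x
    rw [hreal x, ENNReal.ofReal_prod_of_nonneg (fun i _ => Real.rpow_nonneg (Real.exp_pos _).le _)]
    refine Finset.prod_congr rfl fun i hi => ?_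
    rw [ENNReal.ofReal_rpow_of_nonneg (Real.exp_pos _).le (hw0 i hi)]
  -- Hölder with several factors, in `ℝ≥0∞`
  have hH := ENNReal.lintegral_prod_norm_pow_le (μ := μ) s (f := fun i x => ENNReal.ofReal (Real.exp (F i x)))
    (fun i hi => (hFi i hi).aestronglyMeasurable.aemeasurable.ennreal_ofReal) hw1 hw0
  have hnn : ∀ i ∈ s, (0 : ℝ) ≤ ∫ x, Real.exp (F i x) ∂μ := fun i _ => integral_nonneg fun x => (Real.exp_pos _).le
  have hR : ∏ i ∈ s, (∫⁻ x, ENNReal.ofReal (Real.exp (F i x)) ∂μ) ^ w i =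
      ENNReal.ofReal (∏ i ∈ s, (∫ x, Real.exp (F i x) ∂μ) ^ w i) := by
    rw [ENNReal.ofReal_prod_of_nonneg (fun i hi => Real.rpow_nonneg (hnn i hi) _)]
    refine Finset.prod_congr rfl fun i hi => ?_
    rw [← ofReal_integral_eq_lintegral_ofReal (hFi i hi) (ae_of_all _ fun x => (Real.exp_pos _).le),
      ENNReal.ofReal_rpow_of_nonneg (hnn i hi) (hw0 i hi)]
  have hlin : ∫⁻ x, ENNReal.ofReal (Real.exp (∑ i ∈ s, w i * F i x)) ∂μ ≤
      ENNReal.ofReal (∏ i ∈ s, (∫ x, Real.exp (F i x) ∂μ) ^ w i) := by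
    calc ∫⁻ x, ENNReal.ofReal (Real.exp (∑ i ∈ s, w i * F i x)) ∂μ
        = ∫⁻ x, ∏ i ∈ s, ENNReal.ofReal (Real.exp (F i x)) ^ w i ∂μ := lintegral_congr fun x => hpt x
      _ ≤ ∏ i ∈ s, (∫⁻ x, ENNReal.ofReal (Real.exp (F i x)) ∂μ) ^ w i := hH
      _ = _ := hR
  -- measurability and integrability of `e^{Σ wF}`
  have haem : AEMeasurable (fun x => Real.exp (∑ i ∈ s, w i * F i x)) μ := by
    have h1 : AEMeasurable (fun x => ∏ i ∈ s, Real.exp (F i x) ^ w i) μ :=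
      Finset.aemeasurable_fun_prod s fun i hi => ((hFi i hi).aestronglyMeasurable.aemeasurable.pow_const (w i))
    exact h1.congr (ae_of_all _ fun x => (hreal x).symm)
  have hint : Integrable (fun x => Real.exp (∑ i ∈ s, w i * F i x)) μ :=
    ⟨haem.aestronglyMeasurable, (hasFiniteIntegral_iff_ofReal (ae_of_all _ fun x => (Real.exp_pos _).le)).2
      (lt_of_le_of_lt hlin ENNReal.ofReal_lt_top)⟩
  refine ⟨hint, ?_⟩
  rw [← ENNReal.ofReal_le_ofReal_iff (Finset.prod_nonneg fun i hi => Real.rpow_nonneg (hnn i hi) _),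
    ofReal_integral_eq_lintegral_ofReal hint (ae_of_all _ fun x => (Real.exp_pos _).le)]
  exact hlin

/-- **Convexity of the log-partition functional along finite convex combinations**:
`log ∫ e^{Σ_i w_i F_i} dμ ≤ Σ_i w_i log ∫ e^{F_i} dμ` (`w_i ≥ 0`, `Σ w_i = 1`, `e^{F_i}` integrable). [folklore] -/
theorem log_integral_exp_sum_mul_le (s : Finset ι) (w : ι → ℝ) (F : ι → α → ℝ)
    (hw0 : ∀ i ∈ s, 0 ≤ w i) (hw1 : ∑ i ∈ s, w i = 1)
    (hFi : ∀ i ∈ s, Integrable (fun x => Real.exp (F i x)) μ) :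
    Real.log (∫ x, Real.exp (∑ i ∈ s, w i * F i x) ∂μ) ≤ ∑ i ∈ s, w i * Real.log (∫ x, Real.exp (F i x) ∂μ) := by
  obtain ⟨hint, hle⟩ := integral_exp_sum_mul_le_prod_rpow (μ := μ) s w F hw0 hw1 hFi
  have hpos : 0 < ∫ x, Real.exp (∑ i ∈ s, w i * F i x) ∂μ := integral_exp_pos hint
  have hposi : ∀ i ∈ s, 0 < ∫ x, Real.exp (F i x) ∂μ := fun i hi => integral_exp_pos (hFi i hi)
  calc Real.log (∫ x, Real.exp (∑ i ∈ s, w i * F i x) ∂μ)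
      ≤ Real.log (∏ i ∈ s, (∫ x, Real.exp (F i x) ∂μ) ^ w i) := Real.log_le_log hpos hle
    _ = ∑ i ∈ s, Real.log ((∫ x, Real.exp (F i x) ∂μ) ^ w i) :=
        Real.log_prod (fun i hi => (Real.rpow_pos_of_pos (hposi i hi) _).ne')
    _ = ∑ i ∈ s, w i * Real.log (∫ x, Real.exp (F i x) ∂μ) :=
        Finset.sum_congr rfl fun i hi => Real.log_rpow (hposi i hi) _

/-- Plain averages: `log ∫ e^{|s|⁻¹ Σ_i F_i} ≤ |s|⁻¹ Σ_i log ∫ e^{F_i}` for a nonempty finite family. [folklore] -/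
theorem log_integral_exp_avg_le (s : Finset ι) (hs : s.Nonempty) (F : ι → α → ℝ)
    (hFi : ∀ i ∈ s, Integrable (fun x => Real.exp (F i x)) μ) :
    Real.log (∫ x, Real.exp ((s.card : ℝ)⁻¹ * ∑ i ∈ s, F i x) ∂μ) ≤
      (s.card : ℝ)⁻¹ * ∑ i ∈ s, Real.log (∫ x, Real.exp (F i x) ∂μ) := by
  have hcard : (0 : ℝ) < s.card := by exact_mod_cast hs.card_pos
  have h := log_integral_exp_sum_mul_le (μ := μ) s (fun _ => (s.card : ℝ)⁻¹) F (fun _ _ => by positivity)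
    (by rw [Finset.sum_const, nsmul_eq_mul, mul_inv_cancel₀ hcard.ne']) hFi
  simpa only [Finset.mul_sum] using h

end Abstract

/-! ### The torus Wilson state: continuous potentials, translates -/

section Wilson

variable {G : Type} [Group G] [TopologicalSpace G] [IsTopologicalGroup G] [CompactSpace G]
  [MeasurableSpace G] [BorelSpace G]

/-- **Convexity of `F ↦ log E e^F` for the torus Wilson state** (weights): for continuous `F_i` and weights `w_i ≥ 0`,
`Σ w_i = 1`: `log E[exp(Σ_i w_i F_i)] ≤ Σ_i w_i log E[exp F_i]`, `E = wilsonExpectation r.ρ β`. [folklore] -/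
theorem log_wilsonExpectation_exp_sum_mul_le (r : LatticeRep G) (β : ℝ) {L : ℕ} [NeZero L] {ι : Type*}
    (s : Finset ι) (w : ι → ℝ) (hw0 : ∀ i ∈ s, 0 ≤ w i) (hw1 : ∑ i ∈ s, w i = 1)
    {F : ι → GaugeConfig 4 L G → ℝ} (hF : ∀ i ∈ s, Continuous (F i)) :
    Real.log (wilsonExpectation r.ρ β fun U => Real.exp (∑ i ∈ s, w i * F i U)) ≤
      ∑ i ∈ s, w i * Real.log (wilsonExpectation r.ρ β fun U => Real.exp (F i U)) := by
  haveI := isProbabilityMeasure_wilsonMeasure (d := 4) (L := L) (G := G) r.ρ r.continuous β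
  haveI := r.secondCountableTopology
  have hFi : ∀ i ∈ s, Integrable (fun U => Real.exp (F i U)) (wilsonMeasure (d := 4) (L := L) r.ρ β) := fun i hi =>
    (Real.continuous_exp.comp (hF i hi)).integrable_of_hasCompactSupport (HasCompactSupport.of_compactSpace _)
  unfold wilsonExpectation
  exact log_integral_exp_sum_mul_le s w F hw0 hw1 hFi

/-- **Convexity of `F ↦ log E e^F` for the torus Wilson state** (plain averages over a nonempty finite family of continuous
potentials): `log E[exp(|s|⁻¹ Σ_i F_i)] ≤ |s|⁻¹ Σ_i log E[exp F_i]`. [folklore] -/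
theorem log_wilsonExpectation_exp_avg_le (r : LatticeRep G) (β : ℝ) {L : ℕ} [NeZero L] {ι : Type*}
    (s : Finset ι) (hs : s.Nonempty) {F : ι → GaugeConfig 4 L G → ℝ} (hF : ∀ i ∈ s, Continuous (F i)) :
    Real.log (wilsonExpectation r.ρ β fun U => Real.exp ((s.card : ℝ)⁻¹ * ∑ i ∈ s, F i U)) ≤
      (s.card : ℝ)⁻¹ * ∑ i ∈ s, Real.log (wilsonExpectation r.ρ β fun U => Real.exp (F i U)) := by
  haveI := isProbabilityMeasure_wilsonMeasure (d := 4) (L := L) (G := G) r.ρ r.continuous β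
  haveI := r.secondCountableTopology
  have hFi : ∀ i ∈ s, Integrable (fun U => Real.exp (F i U)) (wilsonMeasure (d := 4) (L := L) r.ρ β) := fun i hi =>
    (Real.continuous_exp.comp (hF i hi)).integrable_of_hasCompactSupport (HasCompactSupport.of_compactSpace _)
  unfold wilsonExpectation
  exact log_integral_exp_avg_le s hs F hFi

/-- **Translation-averaged Jensen.**  For ONE continuous potential `F` on the torus configuration space and a nonempty
finite family of torus translations `v : ι → Λ`: `log E[exp(|s|⁻¹ Σ_{a∈s} F ∘ τ_{v a})] ≤ log E[exp F]` — convexity plus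
translation invariance of the torus Wilson state (`wilsonExpectation_comp_torusConfigShift`). [folklore] -/
theorem log_wilsonExpectation_exp_avg_translates_le (r : LatticeRep G) (β : ℝ) {L : ℕ} [NeZero L] {ι : Type*}
    (s : Finset ι) (hs : s.Nonempty) (v : ι → Site 4 L) {F : GaugeConfig 4 L G → ℝ} (hF : Continuous F) :
    Real.log (wilsonExpectation r.ρ β fun U =>
        Real.exp ((s.card : ℝ)⁻¹ * ∑ a ∈ s,
          F (Literature.MathematicalPhysics.QuantumFieldTheory.torusConfigShift (v a) U))) ≤
      Real.log (wilsonExpectation r.ρ β fun U => Real.exp (F U)) := by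
  have hcont : ∀ a ∈ s, Continuous (fun U : GaugeConfig 4 L G =>
      F (Literature.MathematicalPhysics.QuantumFieldTheory.torusConfigShift (v a) U)) := by
    intro a _
    refine hF.comp (continuous_pi fun e => ?_)
    simp only [Literature.MathematicalPhysics.QuantumFieldTheory.torusConfigShift,
      TorusTranslation.torusConfigShift_apply]
    exact continuous_apply _
  refine (log_wilsonExpectation_exp_avg_le r β s hs hcont).trans (le_of_eq ?_)
  have hinv : ∀ a ∈ s, wilsonExpectation r.ρ β (fun U => Real.exp
      (F (Literature.MathematicalPhysics.QuantumFieldTheory.torusConfigShift (v a) U))) =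
      wilsonExpectation r.ρ β (fun U => Real.exp (F U)) := fun a _ =>
    wilsonExpectation_comp_torusConfigShift (d := 4) (L := L) r.ρ β (v a) (fun U => Real.exp (F U))
  rw [Finset.sum_congr rfl fun a ha => by rw [hinv a ha], Finset.sum_const, nsmul_eq_mul, ← mul_assoc,
    inv_mul_cancel₀ (by exact_mod_cast hs.card_pos.ne'), one_mul]

end Wilson

end Summit.QuantumFields.YangMills.Theorems.SourcedPressureJensen

end
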